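import Mathlib
import Summits.NavierStokesRegularity.OSWSelfSimilar.SheetNSLineTorusCascadeExtend
import Literature.Analysis.Fourier.HilbertTransformCircleMultiplier
import Literature.Analysis.Fourier.PeriodicModeConvolution
import HarnessLib

/-!
# Viscous CLM on the torus (`a = 0`, `σ = 2`): THE PDE ↔ CASCADE LINK, part 1 — classical solutions, their window
# modes, the multiplier on slices and the sgn-pairing of the product `ω·Hω`

HONEST FRAMING (cell ns-blowup GROUP B «PROFILE SEARCH», zone Z3, row Z3-U addendum A-F2 of
`HOME/profile/z3/CENSUS-Z3.md`; human rulings D-0035/D-0074): **1-D MODEL — the viscous Constantin–Lax–Majda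
equation `ω_t = ω·Hω + ν ω_xx` on `𝕋 = ℝ/2πℤ` with `H = hilbertTransformCircle` (the tree's periodic Hilbert
transform, `H cos = sin`, `H sin = −cos`); not Euler, not Navier–Stokes; «violates: none — MODEL».** This file and its
sequel `SheetNSLineTorusCascadeLink` close the pen gap carried by every one of the ten landed cascade files («the link
‹solution ⇒ bounded coefficients obeying (C)› is the pen sentence above», `SheetNSLineTorusCascade`, p498092).

OBJECTS. A **classical solution on `[0, T]`** (`IsClassicalSolution ν T ω ωt ωx ωxx`): `ω(t,·)` is `2π`-periodic and
`C²` in `x` for `t ∈ [0,T]` (derivatives `ωx`, `ωxx`, the latter continuous), `ω` is jointly continuous on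
`[0,T] × ℝ`, `∂_t ω = ωt` exists on `(0,T)` with `ωt` jointly continuous there, and the equation
`ωt = ω · H(ω(t,·)) + ν ωxx` holds pointwise on `(0,T) × ℝ`. Its **window modes** `mode ω n t = ∫₀^{2π} e^{−inx} ω(t,x) dx`
(`= modeCoeff 2π n`, `n ∈ ℤ`) and the **cascade variable** `coef ω k t = −(i/π) · mode ω k t` (`k ∈ ℕ`; the
coefficients `c_k` of the analytic signal `z = Hω − iω = Σ_{k≥1} c_k e^{ikx}`).

CONTENTS (all `t`-pointwise statements for `t ∈ [0,T]`, derivatives for `t ∈ (0,T)`):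
* `two_mul_conv_sgn_eq`, `conv_sgn_zero`, `conv_sgn_eq_sum_range` — **the sgn-pairing `l ↔ k − l`**:
  `Σ_{l∈ℤ} a_l·(sgn(k−l)·a_{k−l}) = Σ_{j=0}^{k} a_j a_{k−j}` when `a_0 = 0`, and `= 0` at `k = 0` unconditionally —
  the convolution of an analytic signal with its Hilbert partner is LOWER-TRIANGULAR;
* slices: `lipschitz_slice`, `modeCoeff_hilbert_slice` (`(H ω(t,·))^(m) = −i·sgn m · mode ω m t`, the multiplier theorem
  `Literature…modeCoeff_hilbertTransformCircle`), `summable_norm_mode` (`C²` decay), **`hasSum_conv_sgn`**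
  (`i·2π·(ω·Hω)^(m) = Σ_l mode l · (sgn(m−l)·mode(m−l))`, from `Literature…hasSum_modeCoeff_mul`), `modeCoeff_slice_xx`
  (`(ωxx)^(m) = −m²·mode m`), `hasDerivAt_mode` (`d/dt mode m = (ωt)^(m)` on `(0,T)`, local parametric differentiation),
  `modeCoeff_slice_t` (the equation on modes), `continuousOn_mode`, `exists_norm_mode_le` (`‖mode m‖ ≤ 2π sup|ω(t,·)|`).

bears_on: LADDER-NS N5 / zone Z3 (row Z3-U, A-F2) → N1 linear core. WHAT THIS IS NOT: not NS; no existence statement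
for the MODEL PDE; the conclusions (cascade, blow-up horizon) are in the sequel file.
-/

noncomputable section

namespace Summit.NavierStokesRegularity.OSWSelfSimilar
namespace SheetNSLineTorusCascade

open Finset Real Set Filter MeasureTheory intervalIntegral Complex
open Literature.Analysis.Fourier
open scoped Topology

/-! ### The solution class and its modes -/

/-- **Classical `2π`-periodic solution of the viscous CLM `ω_t = ω·Hω + ν ω_xx` on `[0, T] × ℝ`**, with its partial
derivatives `ωt`, `ωx`, `ωxx` given as functions: periodic `C²` slices with continuous second derivative, joint
continuity of `ω` on `[0,T] × ℝ`, time derivative on `(0,T)` jointly continuous there, and the equation pointwise on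
`(0,T) × ℝ` with `H = hilbertTransformCircle`. [new here — MODEL] -/
structure IsClassicalSolution (ν T : ℝ) (ω ωt ωx ωxx : ℝ → ℝ → ℝ) : Prop where
  /-- every slice is `2π`-periodic -/
  periodic : ∀ t ∈ Icc (0 : ℝ) T, Function.Periodic (ω t) (2 * π)
  /-- first `x`-derivative -/
  hasDeriv_x : ∀ t ∈ Icc (0 : ℝ) T, ∀ x, HasDerivAt (ω t) (ωx t x) x
  /-- second `x`-derivative -/
  hasDeriv_xx : ∀ t ∈ Icc (0 : ℝ) T, ∀ x, HasDerivAt (ωx t) (ωxx t x) x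
  /-- the second derivative of every slice is continuous -/
  cont_xx : ∀ t ∈ Icc (0 : ℝ) T, Continuous (ωxx t)
  /-- joint continuity of `ω` on `[0,T] × ℝ` -/
  cont : ContinuousOn (Function.uncurry ω) (Icc 0 T ×ˢ univ)
  /-- time derivative on the open interval -/
  hasDeriv_t : ∀ t ∈ Ioo (0 : ℝ) T, ∀ x, HasDerivAt (fun s => ω s x) (ωt t x) t
  /-- joint continuity of `ωt` on `(0,T) × ℝ` -/
  cont_t : ContinuousOn (Function.uncurry ωt) (Ioo 0 T ×ˢ univ)
  /-- the equation -/
  pde : ∀ t ∈ Ioo (0 : ℝ) T, ∀ x, ωt t x = ω t x * hilbertTransformCircle (ω t) x + ν * ωxx t x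

/-- The `n`-th window mode of the slice `ω(t,·)`: `∫₀^{2π} e^{−inx} ω(t,x) dx`. [new here — MODEL] -/
def mode (ω : ℝ → ℝ → ℝ) (n : ℤ) (t : ℝ) : ℂ := modeCoeff (2 * π) n (fun x => ((ω t x : ℝ) : ℂ))

/-- The cascade variable `c_k(t) = −(i/π) · (mode k)` — the coefficient of `e^{ikx}` in `z = Hω − iω`. [new here — MODEL] -/
def coef (ω : ℝ → ℝ → ℝ) (k : ℕ) (t : ℝ) : ℂ := -(I / π) * mode ω (k : ℤ) t

variable {ν T : ℝ} {ω ωt ωx ωxx : ℝ → ℝ → ℝ}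

/-! ### The sgn-pairing: the convolution of an analytic signal with its Hilbert partner is lower-triangular -/

/-- The symmetrised pairing sum: if `Σ_l a_l·(sgn(k−l)·a_{k−l})` converges to `S` (`k ∈ ℕ`), then
`2S = Σ_{j=0}^{k} a_j a_{k−j} (sgn(k−j) + sgn j)` — outside `[0, k]` the two signs cancel (`l ↦ k − l` pairing).
[new here — MODEL] -/
theorem two_mul_conv_sgn_eq {a : ℤ → ℂ} (k : ℕ) {S : ℂ}
    (hS : HasSum (fun l : ℤ => a l * ((((k : ℤ) - l).sign : ℂ) * a ((k : ℤ) - l))) S) :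
    2 * S = ∑ j ∈ range (k + 1),
      a j * a ((k : ℤ) - j) * ((((k : ℤ) - j).sign : ℂ) + (((j : ℤ)).sign : ℂ)) := by
  set u : ℤ → ℂ := fun l => a l * ((((k : ℤ) - l).sign : ℂ) * a ((k : ℤ) - l)) with hu
  -- reindex by `l ↦ k − l`
  have hS' : HasSum (fun l : ℤ => u ((k : ℤ) - l)) S := by
    have h := (Equiv.subLeft (k : ℤ)).hasSum_iff.mpr hS
    exact h
  have hsum2 : HasSum (fun l : ℤ => u l + u ((k : ℤ) - l)) (S + S) := hS.add hS'
  -- the symmetrised summand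
  set w : ℤ → ℂ := fun l => a l * a ((k : ℤ) - l) * ((((k : ℤ) - l).sign : ℂ) + ((l.sign : ℤ) : ℂ)) with hw
  have huw : (fun l : ℤ => u l + u ((k : ℤ) - l)) = w := by
    funext l
    simp only [hu, hw, sub_sub_cancel]
    ring
  rw [huw] at hsum2
  -- `w` vanishes off the image of `range (k+1)`
  set F : Finset ℤ := (range (k + 1)).image (Nat.cast : ℕ → ℤ) with hF
  have hzero : ∀ l ∉ F, w l = 0 := by
    intro l hl
    have hl' : l < 0 ∨ (k : ℤ) < l := by
      rcases lt_or_ge l 0 with h | h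
      · exact Or.inl h
      · rcases lt_or_ge (k : ℤ) l with h2 | h2
        · exact Or.inr h2
        · exfalso
          apply hl
          rw [hF, Finset.mem_image]
          exact ⟨l.toNat, by rw [Finset.mem_range]; omega, by omega⟩
    simp only [hw]
    rcases hl' with h | h
    · rw [Int.sign_eq_neg_one_of_neg h, Int.sign_eq_one_of_pos (by omega : (0:ℤ) < (k:ℤ) - l)]
      push_cast; ring
    · rw [Int.sign_eq_one_of_pos (by omega : (0:ℤ) < l), Int.sign_eq_neg_one_of_neg (by omega : (k:ℤ) - l < 0)]
      push_cast; ring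
  have hfin : HasSum w (∑ l ∈ F, w l) := hasSum_sum_of_ne_finset_zero hzero
  have hSS : S + S = ∑ l ∈ F, w l := hsum2.unique hfin
  rw [two_mul, hSS, hF, sum_image (fun x _ y _ h => by exact_mod_cast h)]

/-- **Mode `0` of the pairing vanishes**: `Σ_l a_l·(sgn(−l)·a_{−l}) = 0` (no hypothesis on `a`). [new here — MODEL] -/
theorem conv_sgn_zero {a : ℤ → ℂ} {S : ℂ}
    (hS : HasSum (fun l : ℤ => a l * (((((0 : ℕ) : ℤ) - l).sign : ℂ) * a (((0 : ℕ) : ℤ) - l))) S) : S = 0 := by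
  have h := two_mul_conv_sgn_eq 0 hS
  simp only [zero_add, range_one, sum_singleton, Nat.cast_zero, sub_zero, Int.sign_zero, Int.cast_zero,
    add_zero, mul_zero] at h
  have : (2 : ℂ) ≠ 0 := two_ne_zero
  exact (mul_eq_zero.mp h).resolve_left this

/-- **The pairing is the lower-triangular convolution** when `a_0 = 0`:
`Σ_{l∈ℤ} a_l·(sgn(k−l)·a_{k−l}) = Σ_{j=0}^{k} a_j a_{k−j}` (every `k ∈ ℕ`; the end terms vanish with `a_0`).
[new here — MODEL] -/
theorem conv_sgn_eq_sum_range {a : ℤ → ℂ} (k : ℕ) (h0 : a 0 = 0) {S : ℂ}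
    (hS : HasSum (fun l : ℤ => a l * ((((k : ℤ) - l).sign : ℂ) * a ((k : ℤ) - l))) S) :
    S = ∑ j ∈ range (k + 1), a j * a ((k : ℤ) - j) := by
  have h := two_mul_conv_sgn_eq k hS
  have hterm : ∀ j ∈ range (k + 1),
      a j * a ((k : ℤ) - j) * ((((k : ℤ) - j).sign : ℂ) + (((j : ℤ)).sign : ℂ)) = 2 * (a j * a ((k : ℤ) - j)) := by
    intro j hj
    rw [Finset.mem_range] at hj
    rcases Nat.eq_zero_or_pos j with hj0 | hj0
    · subst hj0; simp [h0]
    rcases eq_or_lt_of_le (Nat.le_of_lt_succ hj) with hjk | hjk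
    · subst hjk; simp [h0]
    · rw [Int.sign_eq_one_of_pos (by omega : (0:ℤ) < (k:ℤ) - j), Int.sign_eq_one_of_pos (by omega : (0:ℤ) < (j:ℤ))]
      push_cast; ring
  rw [sum_congr rfl hterm, ← mul_sum] at h
  exact mul_left_cancel₀ two_ne_zero h


/-! ### Calculus helpers -/

/-- The derivative of a periodic differentiable real function is periodic. [folklore] -/
private theorem periodic_of_hasDerivAt_real {f f' : ℝ → ℝ} {c : ℝ} (hf : ∀ x, HasDerivAt f (f' x) x)
    (hper : Function.Periodic f c) : Function.Periodic f' c := by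
  intro x
  have h1 : HasDerivAt (fun y => f (y + c)) (f' (x + c)) x := (hf (x + c)).comp_add_const x c
  have h3 : (fun y => f (y + c)) = f := funext hper
  rw [h3] at h1
  exact h1.unique (hf x)

/-- A continuous periodic real function is bounded. [folklore] -/
private theorem exists_abs_le_of_periodic {g : ℝ → ℝ} (hg : Continuous g) {L : ℝ} (hL : L ≠ 0)
    (hper : Function.Periodic g L) : ∃ M : ℝ, 0 ≤ M ∧ ∀ y, |g y| ≤ M := by
  obtain ⟨C, hC⟩ := isBounded_iff_forall_norm_le.1 (hper.isBounded_of_continuous hL hg)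
  refine ⟨max C 0, le_max_right _ _, fun y => ?_⟩
  have h := hC (g y) (mem_range_self y)
  rw [Real.norm_eq_abs] at h
  exact h.trans (le_max_left _ _)

/-! ### Slices: regularity consequences -/

section slices

variable (h : IsClassicalSolution ν T ω ωt ωx ωxx)
include h

/-- Slices are continuous. -/
theorem continuous_slice {t : ℝ} (ht : t ∈ Icc (0 : ℝ) T) : Continuous (ω t) :=
  continuous_iff_continuousAt.2 fun x => (h.hasDeriv_x t ht x).continuousAt

/-- Slice derivatives are continuous. -/
theorem continuous_slice_x {t : ℝ} (ht : t ∈ Icc (0 : ℝ) T) : Continuous (ωx t) :=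
  continuous_iff_continuousAt.2 fun x => (h.hasDeriv_xx t ht x).continuousAt

/-- Slice derivatives are periodic. -/
theorem periodic_slice_x {t : ℝ} (ht : t ∈ Icc (0 : ℝ) T) : Function.Periodic (ωx t) (2 * π) :=
  periodic_of_hasDerivAt_real (h.hasDeriv_x t ht) (h.periodic t ht)

/-- Slice second derivatives are periodic. -/
theorem periodic_slice_xx {t : ℝ} (ht : t ∈ Icc (0 : ℝ) T) : Function.Periodic (ωxx t) (2 * π) :=
  periodic_of_hasDerivAt_real (h.hasDeriv_xx t ht) (periodic_slice_x h ht)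

/-- **Slices are Lipschitz** (bounded continuous periodic derivative). [new here — MODEL] -/
theorem lipschitz_slice {t : ℝ} (ht : t ∈ Icc (0 : ℝ) T) : ∃ K : NNReal, LipschitzWith K (ω t) := by
  obtain ⟨M, hM0, hM⟩ := exists_abs_le_of_periodic (continuous_slice_x h ht) (by positivity : (2 * π : ℝ) ≠ 0)
    (periodic_slice_x h ht)
  refine ⟨⟨M, hM0⟩, lipschitzWith_of_nnnorm_deriv_le (fun x => (h.hasDeriv_x t ht x).differentiableAt) fun x => ?_⟩
  rw [(h.hasDeriv_x t ht x).deriv, ← NNReal.coe_le_coe, coe_nnnorm, Real.norm_eq_abs]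
  exact hM x

/-- `H` of a slice is continuous. -/
theorem continuous_hilbert_slice {t : ℝ} (ht : t ∈ Icc (0 : ℝ) T) :
    Continuous (hilbertTransformCircle (ω t)) := by
  obtain ⟨K, hK⟩ := lipschitz_slice h ht
  exact continuous_hilbertTransformCircle hK

/-- **The multiplier on slices**: `(H ω(t,·))^(m) = −i·sgn m · mode ω m t`. [new here — MODEL] -/
theorem modeCoeff_hilbert_slice {t : ℝ} (ht : t ∈ Icc (0 : ℝ) T) (m : ℤ) :
    modeCoeff (2 * π) m (fun x => ((hilbertTransformCircle (ω t) x : ℝ) : ℂ))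
      = (-I * (m.sign : ℂ)) * mode ω m t := by
  obtain ⟨K, hK⟩ := lipschitz_slice h ht
  exact modeCoeff_hilbertTransformCircle hK (h.periodic t ht) m

/-- The modes of a slice are absolutely summable (`C²` decay). -/
theorem summable_norm_mode {t : ℝ} (ht : t ∈ Icc (0 : ℝ) T) : Summable fun n : ℤ => ‖mode ω n t‖ := by
  haveI : Fact (0 < 2 * π) := ⟨by positivity⟩
  exact summable_norm_modeCoeff_of_hasDerivAt_two (T := 2 * π) (f := fun x => ((ω t x : ℝ) : ℂ))
    (f' := fun x => ((ωx t x : ℝ) : ℂ)) (f'' := fun x => ((ωxx t x : ℝ) : ℂ))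
    (fun x => (h.hasDeriv_x t ht x).ofReal_comp) (fun x => (h.hasDeriv_xx t ht x).ofReal_comp)
    (continuous_ofReal.comp (h.cont_xx t ht)) (fun x => by simp [(h.periodic t ht) x])

/-- **The modes of the product `ω·Hω` as the sgn-pairing sum**:
`i·2π·(ω·Hω)^(m) = Σ_{l∈ℤ} mode l · (sgn(m−l) · mode (m−l))`. [new here — MODEL] -/
theorem hasSum_conv_sgn {t : ℝ} (ht : t ∈ Icc (0 : ℝ) T) (m : ℤ) :
    HasSum (fun l : ℤ => mode ω l t * (((m - l).sign : ℂ) * mode ω (m - l) t))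
      (I * (((2 * π : ℝ) : ℂ) * modeCoeff (2 * π) m
        (fun x => ((ω t x : ℝ) : ℂ) * ((hilbertTransformCircle (ω t) x : ℝ) : ℂ)))) := by
  haveI : Fact (0 < 2 * π) := ⟨by positivity⟩
  have hprod := hasSum_modeCoeff_mul (T := 2 * π) (f := fun x => ((ω t x : ℝ) : ℂ))
    (g := fun x => ((hilbertTransformCircle (ω t) x : ℝ) : ℂ))
    (continuous_ofReal.comp (continuous_slice h ht)) (fun x => by simp [(h.periodic t ht) x])
    (summable_norm_mode h ht) (continuous_ofReal.comp (continuous_hilbert_slice h ht)) m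
  have h2 := hprod.mul_left I
  have hfun : (fun l : ℤ => I * (modeCoeff (2 * π) l (fun x => ((ω t x : ℝ) : ℂ))
      * modeCoeff (2 * π) (m - l) (fun x => ((hilbertTransformCircle (ω t) x : ℝ) : ℂ))))
      = fun l => mode ω l t * (((m - l).sign : ℂ) * mode ω (m - l) t) := by
    funext l
    rw [modeCoeff_hilbert_slice h ht (m - l)]
    have key : ∀ A s B : ℂ, I * (A * (-I * s * B)) = A * (s * B) := fun A s B => by
      linear_combination (-(A * s * B)) * Complex.I_mul_I
    simp only [mode]
    exact key _ _ _
  rw [hfun] at h2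
  exact h2

/-- The modes of the second derivative of a slice: `(ωxx(t,·))^(m) = −m² · mode ω m t`. [new here — MODEL] -/
theorem modeCoeff_slice_xx {t : ℝ} (ht : t ∈ Icc (0 : ℝ) T) (m : ℤ) :
    modeCoeff (2 * π) m (fun x => ((ωxx t x : ℝ) : ℂ)) = -((m : ℂ) ^ 2) * mode ω m t := by
  haveI : Fact (0 < 2 * π) := ⟨by positivity⟩
  have hp0 : (fun x => ((ω t x : ℝ) : ℂ)) (2 * π) = (fun x => ((ω t x : ℝ) : ℂ)) 0 := by
    have := (h.periodic t ht) 0; simp only [zero_add] at this; simp [this]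
  have hp1 : (fun x => ((ωx t x : ℝ) : ℂ)) (2 * π) = (fun x => ((ωx t x : ℝ) : ℂ)) 0 := by
    have := (periodic_slice_x h ht) 0; simp only [zero_add] at this; simp [this]
  have h2 := modeCoeff_hasDerivAt_hasDerivAt_eq (T := 2 * π) m (g := fun x => ((ω t x : ℝ) : ℂ))
    (g' := fun x => ((ωx t x : ℝ) : ℂ)) (g'' := fun x => ((ωxx t x : ℝ) : ℂ))
    (fun x _ => (h.hasDeriv_x t ht x).ofReal_comp) (fun x _ => (h.hasDeriv_xx t ht x).ofReal_comp)
    ((continuous_ofReal.comp (h.cont_xx t ht)).intervalIntegrable _ _) hp0 hp1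
  rw [h2, mode]
  congr 1
  have hπ : (π : ℂ) ≠ 0 := by exact_mod_cast Real.pi_ne_zero
  push_cast
  field_simp

/-- **Time derivative of the modes** on `(0, T)`: `d/dt mode m = (ωt(t,·))^(m)`. [new here — MODEL] -/
theorem hasDerivAt_mode {t : ℝ} (ht : t ∈ Ioo (0 : ℝ) T) (m : ℤ) :
    HasDerivAt (mode ω m) (modeCoeff (2 * π) m (fun x => ((ωt t x : ℝ) : ℂ))) t := by
  unfold mode
  exact hasDerivAt_modeCoeff_param_of_mem_Ioo (T := 2 * π) m (G := fun θ φ => ((ω θ φ : ℝ) : ℂ))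
    (Gθ := fun θ φ => ((ωt θ φ : ℝ) : ℂ)) ht
    (fun θ hθ φ => (h.hasDeriv_t θ hθ φ).ofReal_comp)
    (fun θ hθ => continuous_ofReal.comp (continuous_slice h (Ioo_subset_Icc_self hθ)))
    (continuous_ofReal.comp_continuousOn h.cont_t)

/-- The modes of `ωt` through the equation: `(ωt)^(m) = (ω·Hω)^(m) + ν·(ωxx)^(m)`. [new here — MODEL] -/
theorem modeCoeff_slice_t {t : ℝ} (ht : t ∈ Ioo (0 : ℝ) T) (m : ℤ) :
    modeCoeff (2 * π) m (fun x => ((ωt t x : ℝ) : ℂ))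
      = modeCoeff (2 * π) m (fun x => ((ω t x : ℝ) : ℂ) * ((hilbertTransformCircle (ω t) x : ℝ) : ℂ))
        + (ν : ℂ) * modeCoeff (2 * π) m (fun x => ((ωxx t x : ℝ) : ℂ)) := by
  have ht' : t ∈ Icc (0 : ℝ) T := Ioo_subset_Icc_self ht
  have hfun : (fun x => ((ωt t x : ℝ) : ℂ)) = fun x =>
      ((ω t x : ℝ) : ℂ) * ((hilbertTransformCircle (ω t) x : ℝ) : ℂ) + (ν : ℂ) * ((ωxx t x : ℝ) : ℂ) := by
    funext x; rw [h.pde t ht x]; push_cast; ring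
  rw [hfun, modeCoeff_add, modeCoeff_const_mul]
  · exact ((continuous_ofReal.comp (continuous_slice h ht')).mul
      (continuous_ofReal.comp (continuous_hilbert_slice h ht'))).intervalIntegrable _ _
  · exact (continuous_const.mul (continuous_ofReal.comp (h.cont_xx t ht'))).intervalIntegrable _ _

/-- Modes are continuous in time on `[0, T]`. -/
theorem continuousOn_mode (hT : 0 ≤ T) (m : ℤ) : ContinuousOn (mode ω m) (Icc 0 T) := by
  unfold mode
  exact continuousOn_modeCoeff_param (T := 2 * π) m (G := fun θ φ => ((ω θ φ : ℝ) : ℂ)) hT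
    (continuous_ofReal.comp_continuousOn h.cont)

/-- **Uniform bound on the modes of a slice**: `‖mode ω m t‖ ≤ 2π · sup_x |ω(t,x)|` (a bound independent of `m`).
[new here — MODEL] -/
theorem exists_norm_mode_le {t : ℝ} (ht : t ∈ Icc (0 : ℝ) T) : ∃ M : ℝ, ∀ m : ℤ, ‖mode ω m t‖ ≤ M := by
  obtain ⟨B, hB0, hB⟩ := exists_abs_le_of_periodic (continuous_slice h ht) (by positivity : (2 * π : ℝ) ≠ 0)
    (h.periodic t ht)
  refine ⟨B * |2 * π - 0|, fun m => ?_⟩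
  unfold mode modeCoeff
  refine intervalIntegral.norm_integral_le_of_norm_le_const fun x _ => ?_
  rw [norm_mul, Complex.norm_real, Real.norm_eq_abs]
  have h1 : ‖fourier (-m) (x : AddCircle (2 * π))‖ = 1 := by
    rw [fourier_coe_apply, show 2 * π * I * (-m : ℤ) * x / (2 * π : ℝ) = (((2 * π * (-m : ℤ) * x / (2 * π)) : ℝ) : ℂ) * I
      by push_cast; ring, Complex.norm_exp_ofReal_mul_I]
  rw [h1, one_mul]
  exact hB x

end slices

end SheetNSLineTorusCascade
end Summit.NavierStokesRegularity.OSWSelfSimilar
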